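import Mathlib
import Literature.NumberTheory.Transcendental.KZProduct
import Literature.NumberTheory.Transcendental.KZRulesAssociator
import Literature.NumberTheory.Transcendental.KZLogCalculusProofs
import Summits.KontsevichZagierPeriods.KontsevichZagierPeriods.Theorems.InverseLandauTateLiftingTranscSectorEntries

/-!
# `TateLifting` (stmt-KontsevichZagierPeriods-9129), line `Sketch` — THE POLYDISC HAS THE CLASS
# `⟦π⟧ᵏ` (stub 65, `stub_polydiscPow`)

An integrand-`1` representation `p` over the closed polydisc
`D̄ᵏ = {v ∈ ℝ²ᵏ | v₂ᵢ² + v₂ᵢ₊₁² ≤ 1 (i < k)}` has the class `⟦π⟧ᵏ` in the formal period ring of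
Kontsevich–Zagier, where `⟦π⟧` is the class of the disc `KZ.piRep = [{x² + y² ≤ 1}, 1]`:
`tateLifting_polydiscPow`. The lead composes it with the ball stubs into
`k!·[B̄₂ₖ] − [D̄ᵏ] ∈ KZ.relations` (route EulerFormChain's `BallCalibration`).

Proof (entirely inside the landed calculus, no transcendence input): induction on `k`,
strengthened to carry the EXISTENCE of an integrand-`1` representation `sₖ` over `D̄ᵏ`
(`PolydiscPow.main`).

* `k = 0`: `D̄⁰ = ℝ⁰`; `s₀ := [pt, 1] = KZ.IntegralRep.unit`, and every integrand-`1` representation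
  over `ℝ⁰` is congruent to `[pt, 1]` (`KZ.of_sub_of_mem_relations_of_eqOn`), whose class is `1`
  (`KZ.toFormalPeriod_of_unit`).
* `k → k + 1`: `D̄ᵏ⁺¹ = D̄ᵏ × D̄` as a product domain in `ℝ²ᵏ × ℝ²` (`PolydiscPow.polydisc_succ`,
  `Fin.forall_fin_succ'`); `sₖ₊₁ := sₖ · [D̄, 1]` (`KZ.IntegralRep.prod`, integrand `1 ⊗ 1 = 1` by
  `KZ.IntegralRep.prod_integrand_eq`); and for every integrand-`1` representation `p` over `D̄ᵏ⁺¹`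
  Fubini splitting off the last disc (`toFormalPeriod_of_prodSplit`) gives
  `⟦p⟧ = ⟦sₖ⟧ · ⟦π⟧ = ⟦π⟧ᵏ · ⟦π⟧ = ⟦π⟧ᵏ⁺¹`.

No new definitions: the polydisc is written out in the binder shape of the lead's `PolydiscPow`
throughout (`2 * (k + 1)` and `2 * k + 2` agree definitionally).

References: M. Kontsevich, D. Zagier, *Periods* (2001), §1.1 eq. (1), §1.2 rule (1), §4.1 ("the
product of integrals is again an integral (Fubini formula)").
-/

noncomputable section

open MeasureTheory Set
open Literature.NumberTheory.Transcendental

namespace Summit.KontsevichZagierPeriods.InverseLandau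

namespace PolydiscPow

/-- **`D̄ᵏ⁺¹ = D̄ᵏ × D̄`**: the closed polydisc of `ℝ²ᵏ⁺²` is the product domain of the closed
polydisc of the leading `2k` coordinates and the closed unit disc `KZ.piDisc` of the trailing two.
[folklore] -/
theorem polydisc_succ (k : ℕ) :
    {v : Fin (2 * k + 2) → ℝ |
        ∀ i : Fin (k + 1), v ⟨2 * (i : ℕ), by omega⟩ ^ 2 + v ⟨2 * (i : ℕ) + 1, by omega⟩ ^ 2 ≤ 1} =
      {z : Fin (2 * k + 2) → ℝ |
        (fun i => z (Fin.castAdd 2 i)) ∈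
            {v : Fin (2 * k) → ℝ |
              ∀ i : Fin k, v ⟨2 * (i : ℕ), by omega⟩ ^ 2 + v ⟨2 * (i : ℕ) + 1, by omega⟩ ^ 2 ≤ 1} ∧
          (fun j => z (Fin.natAdd (2 * k) j)) ∈ KZ.piDisc} := by
  ext z
  simp only [mem_setOf_eq, Fin.forall_fin_succ', KZ.mem_piDisc]
  exact Iff.rfl

/-- **The induction**: for every `k` there IS an integrand-`1` representation over the closed
polydisc `D̄ᵏ`, and every integrand-`1` representation over `D̄ᵏ` has the class `⟦π⟧ᵏ` (base:
congruence to `[pt, 1]`; step: Fubini splitting `toFormalPeriod_of_prodSplit` off the last disc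
against the representation supplied by the induction hypothesis).
[cite: KontsevichZagier2001, §4.1] -/
theorem main (k : ℕ) :
    (∃ s : KZ.IntegralRep (2 * k),
        s.domain =
          {v | ∀ i : Fin k, v ⟨2 * (i : ℕ), by omega⟩ ^ 2 + v ⟨2 * (i : ℕ) + 1, by omega⟩ ^ 2 ≤ 1} ∧
        ∀ v ∈ s.domain, s.integrand v = 1) ∧
      ∀ p : KZ.IntegralRep (2 * k),
        p.domain =
          {v | ∀ i : Fin k, v ⟨2 * (i : ℕ), by omega⟩ ^ 2 + v ⟨2 * (i : ℕ) + 1, by omega⟩ ^ 2 ≤ 1} →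
        (∀ v ∈ p.domain, p.integrand v = 1) →
          KZ.toFormalPeriod (KZ.of p) = KZ.toFormalPeriod (KZ.of KZ.piRep) ^ k := by
  induction k with
  | zero =>
    refine ⟨⟨KZ.IntegralRep.unit, ?_, ?_⟩, ?_⟩
    · ext v
      simp
    · intro v _
      rfl
    · intro p hp hpi
      rw [pow_zero, ← KZ.toFormalPeriod_of_unit, KZ.toFormalPeriod_eq_iff]
      refine KZ.of_sub_of_mem_relations_of_eqOn ?_ ?_
      · rw [hp]
        ext v
        simp
      · intro v hv
        rw [hpi v hv]
        rfl
  | succ k ih =>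
    obtain ⟨⟨s, hsd, hsi⟩, ih⟩ := ih
    -- the domain hypothesis of `toFormalPeriod_of_prodSplit` for any representation over `D̄ᵏ⁺¹`
    have hdom : ∀ p : KZ.IntegralRep (2 * k + 2),
        p.domain = {v | ∀ i : Fin (k + 1),
          v ⟨2 * (i : ℕ), by omega⟩ ^ 2 + v ⟨2 * (i : ℕ) + 1, by omega⟩ ^ 2 ≤ 1} →
        p.domain = {z | (fun i => z (Fin.castAdd 2 i)) ∈ s.domain ∧
          (fun j => z (Fin.natAdd (2 * k) j)) ∈ KZ.piRep.domain} := by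
      intro p hp
      rw [hp, polydisc_succ, hsd]
      rfl
    refine ⟨⟨s.prod KZ.piRep, ?_, ?_⟩, ?_⟩
    · refine ((polydisc_succ k).trans ?_).symm
      rw [KZ.IntegralRep.prod_domain, ← hsd]
      rfl
    · intro v hv
      rw [KZ.IntegralRep.prod_domain, KZ.IntegralRep.mem_prodDomain] at hv
      rw [KZ.IntegralRep.prod_integrand_eq, KZ.IntegralRep.prodFun_apply, hsi _ hv.1,
        KZ.piRep_integrand, one_mul]
    · intro p hp hpi
      have hd := hdom p hp
      have hi : Set.EqOn p.integrand (fun z => s.integrand (fun i => z (Fin.castAdd 2 i)) *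
          KZ.piRep.integrand (fun j => z (Fin.natAdd (2 * k) j))) p.domain := by
        intro z hz
        have hz' := hz
        rw [hd] at hz'
        dsimp only
        rw [hpi z hz, hsi _ hz'.1, KZ.piRep_integrand, one_mul]
      exact (toFormalPeriod_of_prodSplit p s KZ.piRep hd hi).trans (by rw [ih s hsd hsi, pow_succ])

end PolydiscPow

/-- **THE POLYDISC HAS THE CLASS `⟦π⟧ᵏ`** (stub 65, `stub_polydiscPow`, the body of the lead's
`PolydiscPow`): an integrand-`1` representation over the closed polydisc
`{v ∈ ℝ²ᵏ | v₂ᵢ² + v₂ᵢ₊₁² ≤ 1 (i < k)}` has class `⟦π⟧ᵏ` in the formal period ring (induction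
on `k`, Fubini splitting `toFormalPeriod_of_prodSplit` off the last disc, `KZ.piRep = [D̄, 1]`;
no transcendence input). [cite: KontsevichZagier2001, §4.1] -/
theorem tateLifting_polydiscPow :
    ∀ (k : ℕ) (p : KZ.IntegralRep (2 * k)),
    p.domain = {v | ∀ i : Fin k, v ⟨2 * (i : ℕ), by omega⟩ ^ 2 + v ⟨2 * (i : ℕ) + 1, by omega⟩ ^ 2 ≤ 1} →
    (∀ v ∈ p.domain, p.integrand v = 1) →
    KZ.toFormalPeriod (KZ.of p) = KZ.toFormalPeriod (KZ.of KZ.piRep) ^ k :=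
  fun k => (PolydiscPow.main k).2

end Summit.KontsevichZagierPeriods.InverseLandau

end
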